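import Summits.KontsevichZagierPeriods.KontsevichZagierPeriods.Theorems.HurwitzMicroSectorsNormalFormPrincipleLevelOneMergeBoxSubTriangle
import Literature.NumberTheory.Transcendental.KZDominatedFamilyRelations

/-!
# `NormalFormPrinciple` (stmt-KontsevichZagierPeriods-3869), line `SketchIdeator1` — the leaf
# `stub_boxRigidity` in dimension two, level `N`: the merge gadget (rule 2)

Registered sub-goal `merge_box_sub_triangle_levelN` of the layer "Conjecture 1 for
`[(0,1)², P(x,y)/(1 − (xy)^N)]`" (lead file `…LevelTwo`, wave 3). It is the level-`N` analogue of
`LevelOne.merge_box_sub_triangle` (denominators `1 − x₀x₁`, `1 − z₁`), with the very same proof.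
For `1 ≤ N`, `b < a` and `c ∈ ℚ`, the box representation
`Nr = [(0,1)², c x₀^a x₁^b/(1 − (x₀x₁)^N)]` and the triangle representation
`R = [T, c z₀^{a−b−1} z₁^b/(1 − z₁^N)]`, `T = {0 < z₀ < 1, 0 ≤ z₁ ≤ z₀}`, differ by a relation:

1. (rule 1) `Nr` agrees on the open box with the representation
   `r = [B₀, c x₀^a x₁^b/(1 − (x₀x₁)^N)]` on the band-box `B₀ = {0 < x₀ < 1, 0 ≤ x₁ ≤ 1}` (the
   denominator is positive there since `0 ≤ x₀x₁ < 1` and `N ≠ 0`), and `B₀ ∖ (0,1)²` consists of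
   the two null edges `x₁ ∈ {0, 1}`
   (`KZ.IntegralRep.of_sub_of_restrict_mem_relations`, `KZ.of_sub_of_mem_relations_of_eqOn`);
2. (rule 2) the substitution `z₁ = x₀ x₁` along the last coordinate over the open base `(0,1)`
   (`KZ.of_sub_of_mem_relations_of_affine` with `α = 0`, `β = x₀`, Jacobian `x₀`) carries `B₀`
   onto `T`, and `c x₀^{a−b−1} (x₀x₁)^b/(1 − (x₀x₁)^N) · x₀ = c x₀^a x₁^b/(1 − (x₀x₁)^N)`.

References: M. Kontsevich, D. Zagier, *Periods* (2001), §1.2 rules (1), (2). No definitions are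
introduced.
-/

noncomputable section

open MeasureTheory Set
open Literature.NumberTheory.Transcendental Literature.NumberTheory.Transcendental.KZ
open Literature.ModelTheory.ExponentialFields (IsSemialgebraic)

namespace Summit.KontsevichZagierPeriods.HurwitzMicroSectors.NormalFormPrinciple.PiBox.LevelN

/-- The level-`N` merge identity
`c x^a t^b/(1 − (x t)^N) = c x^{a−b−1} (x t)^b/(1 − (x t)^N) · x` for `b < a`
(`a = (a − b − 1) + b + 1`). [folklore] -/
theorem merge_identity_levelN {a b : ℕ} (hab : b < a) (N : ℕ) (c x t : ℝ) :
    c * (x ^ a * t ^ b) / (1 - (x * t) ^ N) =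
      c * (x ^ (a - b - 1) * (x * t) ^ b) / (1 - (x * t) ^ N) * x := by
  obtain ⟨k, rfl⟩ : ∃ k, a = b + 1 + k := ⟨a - (b + 1), by omega⟩
  have hk : b + 1 + k - b - 1 = k := by omega
  rw [hk]
  ring

/-- The level-`N` merge identity at a point `z` of the band-box, the substituted point being
`(z₀, z₀ z₁) = Fin.snoc (Fin.init z) (0 + z₀ z₁)` (the shape produced by
`KZ.of_sub_of_mem_relations_of_affine` with `α = 0`, `β = z₀`). [folklore] -/
theorem merge_identity_snoc_levelN {a b : ℕ} (hab : b < a) (N : ℕ) (c : ℝ) (z : Fin 2 → ℝ) :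
    c * (z 0 ^ a * z 1 ^ b) / (1 - (z 0 * z 1) ^ N) =
      c * ((Fin.snoc (Fin.init z) (0 + Fin.init z 0 * z (Fin.last 1)) : Fin 2 → ℝ) 0 ^ (a - b - 1) *
          (Fin.snoc (Fin.init z) (0 + Fin.init z 0 * z (Fin.last 1)) : Fin 2 → ℝ) 1 ^ b) /
        (1 - (Fin.snoc (Fin.init z) (0 + Fin.init z 0 * z (Fin.last 1)) : Fin 2 → ℝ) 1 ^ N) *
        Fin.init z 0 := by
  have hi : Fin.init z 0 = z 0 := rfl
  have hl : z (Fin.last 1) = z 1 := rfl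
  rw [LevelOne.merge_snoc_init_apply_zero z, LevelOne.merge_snoc_init_apply_one z, hi, hl, zero_add]
  exact merge_identity_levelN hab N c (z 0) (z 1)

/-- **The merge gadget at level `N`** (Kontsevich–Zagier rule 2; registered sub-goal V3 of the
level-`N` layer of `stub_boxRigidity` in dimension two). For `1 ≤ N` and `b < a`, the box
representation `Nr = [(0,1)², c x₀^a x₁^b/(1 − (x₀x₁)^N)]` and the triangle representation
`R = [T, c z₀^{a−b−1} z₁^b/(1 − z₁^N)]`, `T = {0 < z₀ < 1, 0 ≤ z₁ ≤ z₀}`, differ by a relation: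
`Nr` is congruent (rule 1, two null edges) to the same integrand on the band-box
`{0 < x₀ < 1, 0 ≤ x₁ ≤ 1}` (where `1 − (x₀x₁)^N > 0`), which the substitution `z₁ = x₀x₁` along the
last coordinate (`KZ.of_sub_of_mem_relations_of_affine`, `α = 0`, `β = x₀`, Jacobian `x₀`) carries
onto `T` with `c x₀^{a−b−1}(x₀x₁)^b/(1 − (x₀x₁)^N) · x₀ = c x₀^a x₁^b/(1 − (x₀x₁)^N)`.
[cite: KontsevichZagier2001, §1.2 rules (1), (2)] -/
theorem merge_box_sub_triangle_levelN (N : ℕ) (hN : 1 ≤ N) (a b : ℕ) (c : ℚ) (hab : b < a)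
    (Nr R : IntegralRep 2)
    (hNd : Nr.domain = {x | ∀ i, x i ∈ Set.Ioo (0:ℝ) 1})
    (hNi : EqOn Nr.integrand (fun x => (c : ℝ) * (x 0 ^ a * x 1 ^ b) / (1 - (x 0 * x 1) ^ N))
      Nr.domain)
    (hRd : R.domain = KZlog.band {y : Fin 1 → ℝ | 0 < y 0 ∧ y 0 < 1} (fun _ => (0:ℝ)) (fun y => y 0))
    (hRi : EqOn R.integrand (fun z => (c : ℝ) * (z 0 ^ (a - b - 1) * z 1 ^ b) / (1 - z 1 ^ N))
      R.domain) :
    of Nr - of R ∈ relations := by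
  have hN0 : N ≠ 0 := by omega
  -- the open base `G = (0,1) ⊆ ℝ¹` and the band-box `B₀` over it
  have hG : IsSemialgebraic ℚ {y : Fin 1 → ℝ | 0 < y 0 ∧ y 0 < 1} :=
    isSemialgebraic_unitInterval_fin_one
  have hGo : IsOpen {y : Fin 1 → ℝ | 0 < y 0 ∧ y 0 < 1} :=
    isOpen_Ioo.preimage (continuous_apply 0)
  have hB : IsSemialgebraic ℚ
      (KZlog.band {y : Fin 1 → ℝ | 0 < y 0 ∧ y 0 < 1} (fun _ => (0:ℝ)) (fun _ => (1:ℝ))) :=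
    KZlog.isSemialgebraic_band (by simpa using isSemialgebraicFunOn_ratCast hG 0)
      (by simpa using isSemialgebraicFunOn_ratCast hG 1)
  -- the explicit integrand is semialgebraic on the band-box (its denominator is positive there)
  have hsa : IsSemialgebraicFunOn ℚ
      (KZlog.band {y : Fin 1 → ℝ | 0 < y 0 ∧ y 0 < 1} (fun _ => (0:ℝ)) (fun _ => (1:ℝ)))
      (fun x => (c : ℝ) * (x 0 ^ a * x 1 ^ b) / (1 - (x 0 * x 1) ^ N)) := by
    refine (isSemialgebraicFunOn_aeval_div_aeval hB
      (MvPolynomial.C c * (MvPolynomial.X 0 ^ a * MvPolynomial.X 1 ^ b))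
      (1 - (MvPolynomial.X 0 * MvPolynomial.X 1) ^ N) fun x hx => ?_).congr fun x _ => by simp
    have h : (0 < x 0 ∧ x 0 < 1) ∧ 0 ≤ x 1 ∧ x 1 ≤ 1 := hx
    simp only [map_sub, map_mul, map_pow, map_one, MvPolynomial.aeval_X]
    have h01 : x 0 * x 1 ≤ x 0 * 1 := mul_le_mul_of_nonneg_left h.2.2 h.1.1.le
    have hlt : x 0 * x 1 < 1 := by linarith [h.1.2]
    exact (sub_pos.2 (pow_lt_one₀ (mul_nonneg h.1.1.le h.2.1) hlt hN0)).ne'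
  -- ... and integrable there: the band-box is the open box plus two null edges
  have hNint : IntegrableOn
      (fun x : Fin 2 → ℝ => (c : ℝ) * (x 0 ^ a * x 1 ^ b) / (1 - (x 0 * x 1) ^ N))
      Nr.domain := Nr.integrableOn.congr_fun hNi (IntegralRep.measurableSet_domain_holds Nr)
  have hsub : KZlog.band {y : Fin 1 → ℝ | 0 < y 0 ∧ y 0 < 1} (fun _ => (0:ℝ)) (fun _ => (1:ℝ)) ⊆
      Nr.domain ∪ ({z | z 1 = 0} ∪ {z | z 1 = 1}) := by
    intro z hz
    have h : (0 < z 0 ∧ z 0 < 1) ∧ 0 ≤ z 1 ∧ z 1 ≤ 1 := hz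
    rcases h.2.1.eq_or_lt with h0 | h0
    · exact Or.inr (Or.inl h0.symm)
    rcases h.2.2.lt_or_eq with h1 | h1
    · refine Or.inl ?_
      rw [hNd]
      exact Fin.forall_fin_two.2 ⟨⟨h.1.1, h.1.2⟩, ⟨h0, h1⟩⟩
    · exact Or.inr (Or.inr h1)
  have hint : IntegrableOn
      (fun x : Fin 2 → ℝ => (c : ℝ) * (x 0 ^ a * x 1 ^ b) / (1 - (x 0 * x 1) ^ N))
      (KZlog.band {y : Fin 1 → ℝ | 0 < y 0 ∧ y 0 < 1} (fun _ => (0:ℝ)) (fun _ => (1:ℝ))) :=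
    (hNint.union ((IntegrableOn.of_measure_zero
      (Measure.pi_hyperplane (fun _ => (volume : Measure ℝ)) 1 0)).union
      (IntegrableOn.of_measure_zero
        (Measure.pi_hyperplane (fun _ => (volume : Measure ℝ)) 1 1)))).mono_set hsub
  -- the representation `r = [B₀, c x₀^a x₁^b/(1 − (x₀x₁)^N)]`
  obtain ⟨r, hrd, hri⟩ : ∃ r : IntegralRep 2,
      r.domain = KZlog.band {y : Fin 1 → ℝ | 0 < y 0 ∧ y 0 < 1} (fun _ => (0:ℝ)) (fun _ => (1:ℝ)) ∧
      r.integrand = fun x => (c : ℝ) * (x 0 ^ a * x 1 ^ b) / (1 - (x 0 * x 1) ^ N) :=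
    ⟨⟨_, _, hB, hsa, hint⟩, rfl, rfl⟩
  -- (rule 1) `Nr` versus `r`: restriction to the open box and congruence
  have hEr : Nr.domain ⊆ r.domain := by
    intro z hz
    rw [hNd] at hz
    have h0 := hz 0
    have h1 := hz 1
    rw [hrd]
    show (0 < z 0 ∧ z 0 < 1) ∧ 0 ≤ z 1 ∧ z 1 ≤ 1
    exact ⟨⟨h0.1, h0.2⟩, h1.1.le, h1.2.le⟩
  have hnull : volume (r.domain \ Nr.domain) = 0 := by
    refine measure_mono_null (fun z hz => ?_)
      (measure_union_null (Measure.pi_hyperplane (fun _ => (volume : Measure ℝ)) 1 0)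
        (Measure.pi_hyperplane (fun _ => (volume : Measure ℝ)) 1 1))
    rcases hsub (hrd ▸ hz.1) with h | h
    · exact absurd h hz.2
    · exact h
  have e1 : of r - of (r.restrict Nr.domain Nr.isSemialgebraic_domain hEr) ∈ relations :=
    r.of_sub_of_restrict_mem_relations Nr.isSemialgebraic_domain hEr hnull
  have e2 : of Nr - of (r.restrict Nr.domain Nr.isSemialgebraic_domain hEr) ∈ relations :=
    of_sub_of_mem_relations_of_eqOn rfl (by rw [IntegralRep.integrand_restrict, hri]; exact hNi)
  -- (rule 2) `r` versus `R`: the substitution `z₁ = x₀ x₁` along the last coordinate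
  have key : ∀ z ∈ r.domain, r.integrand z =
      R.integrand (Fin.snoc (Fin.init z) (0 + Fin.init z 0 * z (Fin.last 1))) * Fin.init z 0 := by
    intro z hz
    rw [hrd] at hz
    obtain ⟨hzG, h0, h1⟩ := KZlog.mem_band.1 hz
    have hx : 0 < Fin.init z 0 ∧ Fin.init z 0 < 1 := hzG
    have h0' : 0 ≤ z (Fin.last 1) := h0
    have h1' : z (Fin.last 1) ≤ 1 := h1
    have hw : (Fin.snoc (Fin.init z) (0 + Fin.init z 0 * z (Fin.last 1)) : Fin 2 → ℝ) ∈
        R.domain := by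
      rw [hRd]
      refine KZlog.mem_band.2 ?_
      rw [Fin.init_snoc, Fin.snoc_last]
      exact ⟨hzG, by nlinarith [mul_nonneg hx.1.le h0'],
        by nlinarith [mul_le_mul_of_nonneg_left h1' hx.1.le]⟩
    rw [hRi hw, hri]
    exact merge_identity_snoc_levelN hab N c z
  have e3 : of r - of R ∈ relations :=
    of_sub_of_mem_relations_of_affine (m := 1) hGo (α := fun _ => (0:ℝ)) (β := fun y => y 0)
      (a := fun _ => (0:ℝ)) (b := fun _ => (1:ℝ)) (a' := fun _ => (0:ℝ)) (b' := fun y => y 0)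
      (by simpa using isSemialgebraicFunOn_ratCast hG 0) (isSemialgebraicFunOn_apply hG 0)
      (differentiableOn_const 0) (differentiableOn_apply 0 _) (fun y hy => hy.1) r R hrd hRd
      (fun y _ => by ring) (fun y _ => by ring) key
  -- bookkeeping
  have e : of Nr - of R = (of Nr - of (r.restrict Nr.domain Nr.isSemialgebraic_domain hEr)) -
      (of r - of (r.restrict Nr.domain Nr.isSemialgebraic_domain hEr)) + (of r - of R) := by
    abel
  rw [e]
  exact relations.add_mem (relations.sub_mem e2 e1) e3

end Summit.KontsevichZagierPeriods.HurwitzMicroSectors.NormalFormPrinciple.PiBox.LevelN
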